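import Literature.NumberTheory.LocalFields.PadicAlgebraOneUnitExpLog
import HarnessLib

/-!
# The logarithmic series on one-units of a complete ultrametric `ℚ_p`-algebra:
# `exp(L u) = u` and `cosh((L u)²) = (u + u⁻¹)/2` (Gouvêa 1993 §5.7; proofs only)

Topic `Literature/NumberTheory/LocalFields`, namespace `Literature.NumberTheory.LocalFields.PadicAlgebra`
(cell `bsd-eis`, seat `bsd-eis-k5-c4` g3). The logarithm `L(y) = −∑_{n≥1}(1−y)ⁿ/n` of a complete
ultrametric normed `ℚ_p`-algebra field `F` (the tree's generic `IwasawaLog` §A series, written out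
as a `tsum`; for `F = ℚ_p` it is `padicLog` on one-units) satisfies the two hypotheses of
`PadicAlgebra.exp_log_eq_self` on the ball `‖u − 1‖ ≤ p⁻¹`, `p ≠ 2`:

* `logSeries_mul_of_le` — additivity (`IwasawaLog.logSeries_mul`);
* `norm_logSeries_one_add_sub_le` — `‖L(1+t) − t‖ ≤ 2‖t‖²` (port of
  `SteinWuthrich2013.norm_padicLog_one_add_sub_le`);
* `exp_logSeries_eq_self`, `coshOfSq_logSeries_sq` — **`exp(L u) = u`** and
  **`coshOfSq((L u)²) = (u + u⁻¹)/2`** for `‖u − 1‖ ≤ p⁻¹` (used at `F = ℂ_p` for the Tate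
  uniformisation at a non-split multiplicative prime, `SteinWuthrich2013.exists_isMultCanonical`).

## Sources
* F. Q. Gouvêa, *p-adic Numbers: An Introduction* (1993), §5.7 (Lemma 5.7.1, Prop. 5.7.8).
  [Gouvea1993PadicNumbers]
* K. Iwasawa, *Lectures on p-adic L-functions* (1972), §4.4. [Iwasawa1972PadicL]
-/

noncomputable section

open scoped Classical

open Filter Topology Literature.NumberTheory.Transcendental Literature.NumberTheory.EllipticCurves
  Literature.NumberTheory.EllipticCurves.SteinWuthrich2013

namespace Literature.NumberTheory.LocalFields.PadicAlgebra

/-- `(n + 2) rⁿ ≤ 2` for `0 ≤ r ≤ 1/2`. [folklore] -/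
private theorem aux_bound' {r : ℝ} (hr0 : 0 ≤ r) (hr : r ≤ 1 / 2) (n : ℕ) :
    ((n : ℝ) + 2) * r ^ n ≤ 2 := by
  induction n with
  | zero => simp
  | succ n ih =>
    have h1 : ((n : ℝ) + 1 + 2) * r ^ (n + 1) = (((n : ℝ) + 3) * r) * r ^ n := by ring
    rw [Nat.cast_succ, h1]
    have h2 : ((n : ℝ) + 3) * r ≤ (n : ℝ) + 2 := by nlinarith
    calc ((n : ℝ) + 3) * r * r ^ n ≤ ((n : ℝ) + 2) * r ^ n :=
          mul_le_mul_of_nonneg_right h2 (pow_nonneg hr0 n)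
      _ ≤ 2 := ih

/-- `p⁻¹ ≤ 1/2`. [folklore] -/
private theorem inv_p_le_half' {p : ℕ} [hp : Fact p.Prime] : (p : ℝ)⁻¹ ≤ 1 / 2 := by
  rw [one_div]
  exact inv_anti₀ (by norm_num) (by exact_mod_cast hp.out.two_le)

variable {p : ℕ} [hp : Fact p.Prime] {F : Type*} [NormedField F] [instF : NormedAlgebra ℚ_[p] F]
  [instU : IsUltrametricDist F] [CompleteSpace F]

include instF

/-- **Additivity of the logarithmic series on the ball `‖u − 1‖ ≤ p⁻¹`** (indeed on all principal
units, `IwasawaLog.logSeries_mul`). [Iwasawa 1972, §4.4] [cite: Iwasawa1972PadicL, §4.4] -/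
theorem logSeries_mul_of_le {u v : F} (hu : ‖u - 1‖ ≤ (p : ℝ)⁻¹) (hv : ‖v - 1‖ ≤ (p : ℝ)⁻¹) :
    (∑' n : ℕ, -((1 - u * v) ^ (n + 1)) / (n + 1 : F)) =
      (∑' n : ℕ, -((1 - u) ^ (n + 1)) / (n + 1 : F)) + ∑' n : ℕ, -((1 - v) ^ (n + 1)) / (n + 1 : F) := by
  have hp1 : (p : ℝ)⁻¹ < 1 := inv_lt_one_of_one_lt₀ (by exact_mod_cast hp.out.one_lt)
  have hu' : ‖1 - u‖ < 1 := by rw [norm_sub_rev]; exact hu.trans_lt hp1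
  have hv' : ‖1 - v‖ < 1 := by rw [norm_sub_rev]; exact hv.trans_lt hp1
  exact IwasawaLog.logSeries_mul (p := p) hu' hv'

/-- **`‖L(1+t) − t‖ ≤ 2‖t‖²` for `‖t‖ ≤ p⁻¹`**: `L(1+t) = Σ_{n≥1} (−1)^{n+1}tⁿ/n` with `‖tⁿ/n‖ ≤ n‖t‖ⁿ`
and `n rⁿ⁻² ≤ 2` (`r ≤ 1/2`). Port of `SteinWuthrich2013.norm_padicLog_one_add_sub_le`.
[Gouvêa 1993, §5.7 (Lemma 5.7.1, Prop. 5.7.8)] [cite: Gouvea1993PadicNumbers, §5.7 Prop. 5.7.8 (PDF p. 124)] -/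
theorem norm_logSeries_one_add_sub_le {t : F} (ht : ‖t‖ ≤ (p : ℝ)⁻¹) :
    ‖(∑' n : ℕ, -((1 - (1 + t)) ^ (n + 1)) / (n + 1 : F)) - t‖ ≤ 2 * ‖t‖ ^ 2 := by
  set r := ‖t‖ with hr
  have hr0 : 0 ≤ r := norm_nonneg t
  have hr2 : r ≤ 1 / 2 := ht.trans (inv_p_le_half' (p := p))
  have hr1 : r < 1 := by linarith
  have hfun : (fun n : ℕ => -((1 - (1 + t)) ^ (n + 1)) / (n + 1 : F)) =
      fun n : ℕ => -((-t) ^ (n + 1)) / (n + 1 : F) := by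
    funext n; rw [show (1 : F) - (1 + t) = -t by ring]
  have hS : Summable fun n : ℕ => -((-t) ^ (n + 1)) / (n + 1 : F) :=
    IwasawaLog.summable_logTerm (p := p) (by rw [norm_neg]; exact hr1)
  have hsplit : (∑' n : ℕ, -((1 - (1 + t)) ^ (n + 1)) / (n + 1 : F)) =
      t + ∑' n : ℕ, -((-t) ^ (n + 2)) / (n + 2 : F) := by
    rw [hfun, hS.tsum_eq_zero_add]
    congr 1
    · simp
    · refine tsum_congr fun n => ?_
      push_cast
      ring_nf
  rw [hsplit, add_sub_cancel_left]
  refine IsUltrametricDist.norm_tsum_le_of_forall_le_of_nonneg (by positivity) fun n => ?_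
  have hn : ((n : F) + 2) = ((n + 2 : ℕ) : F) := by push_cast; ring
  rw [norm_div, norm_neg, norm_pow, norm_neg, hn, ← hr, div_eq_mul_inv, ← norm_inv]
  calc r ^ (n + 2) * ‖((n + 2 : ℕ) : F)⁻¹‖ ≤ r ^ (n + 2) * ((n + 2 : ℕ) : ℝ) :=
        mul_le_mul_of_nonneg_left (IwasawaLog.norm_inv_natCast_le p (by omega)) (pow_nonneg hr0 _)
    _ = (((n : ℝ) + 2) * r ^ n) * r ^ 2 := by push_cast; ring
    _ ≤ 2 * r ^ 2 := mul_le_mul_of_nonneg_right (aux_bound' hr0 hr2 n) (sq_nonneg _)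

/-- **`exp(L u) = u` for `‖u − 1‖ ≤ p⁻¹`, `p ≠ 2`, with `L` the logarithmic series** of a complete
ultrametric normed `ℚ_p`-algebra field. [Gouvêa 1993, Prop. 5.7.8]
[cite: Gouvea1993PadicNumbers, §5.7 Prop. 5.7.8 (PDF p. 124)] -/
theorem exp_logSeries_eq_self (hp2 : p ≠ 2) {u : F} (hu : ‖u - 1‖ ≤ (p : ℝ)⁻¹) :
    NormedSpace.exp (∑' n : ℕ, -((1 - u) ^ (n + 1)) / (n + 1 : F)) = u :=
  exp_log_eq_self (Lg := fun y : F => ∑' n : ℕ, -((1 - y) ^ (n + 1)) / (n + 1 : F)) hp2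
    (fun _ _ hu hv => logSeries_mul_of_le hu hv) (fun _ ht => norm_logSeries_one_add_sub_le ht) hu

/-- **`coshOfSq((L u)²) = (u + u⁻¹)/2` for `‖u − 1‖ ≤ p⁻¹`, `p ≠ 2`, with `L` the logarithmic series.**
[Gouvêa 1993, Prop. 5.7.8; Stein–Wuthrich 2013, §4.2] [cite: Gouvea1993PadicNumbers, §5.7 Prop. 5.7.8 (PDF p. 124)] -/
theorem coshOfSq_logSeries_sq (hp2 : p ≠ 2) {u : F} (hu : ‖u - 1‖ ≤ (p : ℝ)⁻¹) :
    coshOfSq ((∑' n : ℕ, -((1 - u) ^ (n + 1)) / (n + 1 : F)) ^ 2) = (u + u⁻¹) / 2 :=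
  coshOfSq_log_sq (Lg := fun y : F => ∑' n : ℕ, -((1 - y) ^ (n + 1)) / (n + 1 : F)) hp2
    (fun _ _ hu hv => logSeries_mul_of_le hu hv) (fun _ ht => norm_logSeries_one_add_sub_le ht) hu

end Literature.NumberTheory.LocalFields.PadicAlgebra

end
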